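import Summits.QuantumFields.YangMills.Theorems.UnitScaleTiltMinimiserStabilityRegPrVariational
import Literature.MathematicalPhysics.QuantumFieldTheory.Balaban1983to89.T3SectASteps
import HarnessLib

/-!
# Route `UnitScaleTilt`, crux K1 child «MinimiserStabilityRegPr» (stmt-QuantumFields-19200), registered stub `stub_variational` (v3d 511ba6194f4d04b9):
# [Balaban1985Variational] THEOREM 1 AT THE d = 3 CARRIERS BY THE PRINTED INDUCTION ON `k` (Sect. A) WITH ITS ARCHITECTURE DISCHARGED —
# from exactly Prop 7-from-a-background-(14), Prop 8 and the Sect. F conclusion at `T3Thm1Carrier.famX L`; hence the stub from those three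
# and the located attainment over (6)(ε₀)

Cell `ym3-torus` ∕ fleet seat `ym-ust-19200-p1` (HUMAN RULING D-0037, YM ladder rung R3).  WHAT THIS IS NOT: nothing of Bałaban's analysis is
proved — Proposition 7 (as proved in print from a background with (14), Sects. B–E), Proposition 8 (Sect. F pp.300–304) and the Sect. F regularity
conclusion (169) are HYPOTHESES (the last two literally the LQB lane's `B11.Prop8Printed` ∕ `B11.SectFPrinted` at the family of carriers
`T3Thm1Carrier.famX L`; the first in the carrier's vocabulary with the background of (14) read as «`U₀ ∈ 𝔘_k(L³B₃ε₁)` and `Ū₀ = V`», `C₁ = L³`).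
WHAT IS PROVED is the printed ARCHITECTURE of Theorem 1 (p. 279 «Theorem 1 will be proved by induction with respect to k», Sect. A (11)–(14))
for the (0.4)-averaging pure-small-field problem of the T³ family, with EVERY architecture leaf a tree theorem: (11) the datum one level up and the
`k = 1` background «U₀ = V₀» are the exact averaging section (`T3SectASteps.stepA11`, `sat14_base`, `B₃ > 4`), (12)–(13) the lift of the
level-`(k−1)` minimiser with `C₁ = L³` (`T3SectASteps.mem_regFibrePr_height_succ`).  The LQB lane's packaged induction `B11Thm1.thm1At_allLevels`
cannot be instantiated at this carrier (its dictionary law (iii) in the global reading is the located gap G-K1aR-2, cell finding F-g7-2); here the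
law is used only in its valid direction — a minimiser over the BIG fibre (6)(O₁C₁B₃ε₁) lying in the SMALL fibre (8) minimises over (8) — which
needs `O₁C₁ ≥ 1` (`O₁ ≥ 1`, `C₁ = L³ ≥ 1`; print's `ε₀ = O(1)C₁B₃ε₁ ≥ B₃ε₁`).

* §1 `thm1_clauses_of_background_T3` — Theorem 1's three clauses at one carrier from a background with (14) (p. 281/299/304–305 assembly).
* §2 `background_T3` — the Sect. A induction on `k = K − n`: every (7)-datum admits a background with (14), `C₁ = L³`.
* §3 **`thm1At_fam_of_prop7_prop8_sectF`** — `∃ C, C.B₃ = B₃ ∧ (1 ≤ M(ε₁) on (0, a₁]) ∧ ∀ i, Thm1At C (fam L i)`;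
  **`stub_variational_of_leaves`** — the registered body of `stub_variational` from {Prop 7-from-(14), Prop 8, Sect. F, attainment over (6)(ε₀)}.

References: T. Bałaban, CMP 102 (1985) 277–309 [Balaban1985Variational] (Thm 1 p.279, Sect. A (11)–(14) pp.279–280, p.281, Prop 7 p.299, Prop 8
p.304, Sect. F (169) p.305).
-/

noncomputable section

namespace Summit.QuantumFields.YangMills.Theorems.Variational

open Literature.MathematicalPhysics.QuantumFieldTheory.Balaban1983to89
open T3ContinuumYM3Torus T3LowerAlongMinimisersSplit T3AvgDivergenceSplit T3ExistSplit T3Thm1Carrier T3SectASteps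
open T3PrintedRegularMinimiser T3PrintedMinimiserExistence
open B11 (Prop8Printed SectFPrinted Regularity)
open B11Thm1 (Exists8 Unique6 Reg910 Thm1At)

/-! ## §1 Theorem 1's clauses at one carrier from a background with (14) -/

/-- **THEOREM 1 AT ONE d = 3 CARRIER ⇐ A BACKGROUND WITH (14)** — the content of Sects. B–F as organised on p. 281, p. 299 and pp. 304–305, for the
(0.4)-averaging problem of the family: for a (7)-datum `V` of height `n < K`, `0 < ε₁ ≤ a₁` (`a₁ ≤ a₁′, a_F, a₅/(O₁L³B₃), a_F·R_M`, `O₁ ≥ 1`) and a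
background `U₀ ∈ 𝔘_k(L³B₃ε₁)` with `Ū₀ = V`: (8) (Prop 7's minimal orbit in (6)(O₁L³B₃ε₁) lies in (8) by Prop 8, and minimises there since
(8) ⊆ (6)(O₁L³B₃ε₁)), uniqueness in (6)(ε₀) for `B₃ε₁ ≤ ε₀ ≤ a₀` (Prop 7's first clause, criticality in reading R2), and (9)–(10) at unit cubes
(Sect. F, `1 ≤ R_M·a_F/ε₁`). [cite: Balaban1985Variational, Thm 1 p.279, Prop 7 p.299, Prop 8 p.304, Sect. F (169) p.305] -/
theorem thm1_clauses_of_background_T3 {L : ℕ} (hL : 1 < L) {B₃ a₀ a₁' O₁ a₅ aF B₄ RM a₁ : ℝ} (hB₃ : 0 < B₃) (hO₁ : 1 ≤ O₁)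
    (h1 : a₁ ≤ a₁') (h2 : a₁ ≤ aF) (h3 : a₁ ≤ a₅ / (O₁ * (L : ℝ) ^ 3 * B₃)) (h4 : a₁ ≤ aF * RM)
    (H7 : ∀ (i : Idx L) (ε₀ ε₁ : ℝ), 0 < ε₁ → ∀ V : (famX L i).Bdry, (famX L i).Reg7 ε₁ V →
      ∀ U₀ : (famX L i).Cfg, (famX L i).InU ((L : ℝ) ^ 3 * B₃ * ε₁) U₀ → (famX L i).InB V U₀ →
        (ε₀ ≤ a₀ → B₃ * ε₁ ≤ ε₀ → (famX L i).AtMostOneCriticalOrbit ε₀ V) ∧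
        (ε₁ ≤ a₁' → ∃ U : (famX L i).Cfg, (famX L i).OnMinimalOrbit (O₁ * (L : ℝ) ^ 3 * B₃ * ε₁) V U))
    (H8 : ∀ (i : Idx L) (ε₀ ε₁ : ℝ), 0 < ε₁ → ∀ (V : (famX L i).Bdry) (U : (famX L i).Cfg),
      (famX L i).Reg7 ε₁ V → (famX L i).InU ε₀ U → (famX L i).InB V U → (famX L i).IsCritical V U → ε₀ ≤ a₅ → (famX L i).InU (B₃ * ε₁) U)
    (HF : ∀ (i : Idx L) (ε₁ : ℝ) (V : (famX L i).Bdry) (U : (famX L i).Cfg), 0 < ε₁ → ε₁ ≤ aF → (famX L i).Reg7 ε₁ V →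
      (famX L i).InU (B₃ * ε₁) U → (famX L i).InB V U → (famX L i).IsCritical V U →
        ∀ c : (famX L i).Cube, (famX L i).sizeM c ≤ RM * (aF / ε₁) → Regularity (famX L i).toVarProblem B₃ B₄ ε₁ U c)
    (i : Idx L) (ε₁ : ℝ) (hε₁ : 0 < ε₁) (hε₁a : ε₁ ≤ a₁) (V : (famX L i).Bdry) (hV : (famX L i).Reg7 ε₁ V)
    (U₀ : (famX L i).Cfg) (hU₀ : (famX L i).InU ((L : ℝ) ^ 3 * B₃ * ε₁) U₀) (hU₀B : (famX L i).InB V U₀) :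
    Exists8 (fam L i) B₃ ε₁ V ∧ Unique6 (fam L i) a₀ B₃ ε₁ V ∧ Reg910 (fam L i) B₃ B₄ ε₁ 1 V := by
  obtain ⟨⟨F, n, K⟩, hF, hnK⟩ := i
  have hL1 : (1 : ℝ) ≤ L := by exact_mod_cast hL.le
  have hK : 0 < O₁ * (L : ℝ) ^ 3 * B₃ := by positivity
  have hBε : 0 < B₃ * ε₁ := mul_pos hB₃ hε₁
  have hbig : 0 < O₁ * (L : ℝ) ^ 3 * B₃ * ε₁ := mul_pos hK hε₁
  -- `(8) ⊆ (6)(O₁L³B₃ε₁)` : `B₃ε₁ ≤ O₁L³B₃ε₁`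
  have hOL : 1 ≤ O₁ * (L : ℝ) ^ 3 := by nlinarith [one_le_pow₀ (n := 3) hL1]
  have hsub : B₃ * ε₁ ≤ O₁ * (L : ℝ) ^ 3 * B₃ * ε₁ := by nlinarith
  -- Prop 8's window: `O₁L³B₃ε₁ ≤ a₅`
  have hε₀a₅ : O₁ * (L : ℝ) ^ 3 * B₃ * ε₁ ≤ a₅ := by
    have hKa : a₁ * (O₁ * (L : ℝ) ^ 3 * B₃) ≤ a₅ := (le_div_iff₀ hK).1 h3
    nlinarith [mul_le_mul_of_nonneg_left hε₁a hK.le]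
  have H7i := fun ε₀ : ℝ => H7 ⟨(F, n, K), hF, hnK⟩ ε₀ ε₁ hε₁ V hV U₀ hU₀ hU₀B
  -- (8): existence of a minimal orbit in (8)
  have hex : Exists8 (fam L ⟨(F, n, K), hF, hnK⟩) B₃ ε₁ V := by
    obtain ⟨U, hU⟩ := (H7i a₀).2 (hε₁a.trans h1)
    obtain ⟨hUmem, hUmin⟩ := (onMinimalOrbit_iff _ V U).mp hU
    have hcrit : (famX L ⟨(F, n, K), hF, hnK⟩).IsCritical V U := ⟨_, hbig, hUmem, hUmin⟩
    have hIn : (famX L ⟨(F, n, K), hF, hnK⟩).InU (O₁ * (L : ℝ) ^ 3 * B₃ * ε₁) U := ((mem_regFibrePr_iff F).mp hUmem).2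
    have hB : (famX L ⟨(F, n, K), hF, hnK⟩).InB V U := hUmem.1.1
    have h8U : RegPr F n K (B₃ * ε₁) U := H8 ⟨(F, n, K), hF, hnK⟩ _ ε₁ hε₁ V U hV hIn hB hcrit hε₀a₅
    have hU8 : U ∈ regFibrePr F n K hnK.le (B₃ * ε₁) V := (mem_regFibrePr_iff F).mpr ⟨hB, h8U⟩
    exact (exists8_iff B₃ ε₁ V).mpr ⟨U, hU8, hUmin.on_subset (regFibrePr_mono F hsub V)⟩
  refine ⟨hex, ?_, ?_⟩
  · -- uniqueness in (6)(ε₀): Prop 7, first clause, with criticality in reading R2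
    intro ε₀ hlo hhi U hU
    obtain ⟨hUmem, hUmin⟩ := (onMinimalOrbit_iff _ V U).mp hU
    have hε₀ : 0 < ε₀ := hBε.trans_le hlo
    have hAM := (H7i ε₀).1 hhi hlo
    have hU6 : U ∈ regFibrePr F n K hnK.le ε₀ V := regFibrePr_mono F hlo V hUmem
    refine ⟨hU6, fun U' hU' hU'min => ?_⟩
    exact hAM U U' ((mem_regFibrePr_iff F).mp hU6).2 hU6.1.1 ⟨_, hBε, hUmem, hUmin⟩
      ((mem_regFibrePr_iff F).mp hU').2 hU'.1.1 ⟨ε₀, hε₀, hU', hU'min⟩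
  · -- (9)–(10) at unit cubes: Sect. F, the cover `1 ≤ R_M·a_F/ε₁`
    intro U hU c hc
    obtain ⟨hUmem, hUmin⟩ := (onMinimalOrbit_iff _ V U).mp hU
    have hcov : (1 : ℝ) ≤ RM * (aF / ε₁) := by
      rw [mul_comm, div_mul_eq_mul_div, le_div_iff₀ hε₁, one_mul]
      exact hε₁a.trans h4
    have hcF : (famX L ⟨(F, n, K), hF, hnK⟩).sizeM c ≤ RM * (aF / ε₁) := hc.trans hcov
    exact HF ⟨(F, n, K), hF, hnK⟩ ε₁ V U hε₁ (hε₁a.trans h2) hV ((mem_regFibrePr_iff F).mp hUmem).2 hUmem.1.1 ⟨_, hBε, hUmem, hUmin⟩ c hcF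

/-! ## §2 The induction on `k = K − n` of Sect. A: every (7)-datum admits a background with (14), `C₁ = L³` -/

/-- **THE BACKGROUND SUPPLY OF SECT. A, PROVED for the d = 3 carriers** (induction on `k = K − n`; p. 279 «Theorem 1 will be proved by induction
with respect to k», (11)–(14) pp. 279–280): under the hypotheses of `thm1_clauses_of_background_T3` and `B₃ > 4`, every (7)-datum `V` of height
`n < K` with `0 < ε₁ ≤ a₁` admits `U₀ ∈ 𝔘_k(L³B₃ε₁)` with `Ū₀ = V` — for `k = 1` «we take simply U₀ = V₀» (the exact averaging section,
`T3SectASteps.sat14_base`), for `k + 1` the minimiser of Theorem 1 at height `n + 1` over the datum `V₀ = secTo V` ((11), `stepA11`), lifted by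
(12)–(13) (`mem_regFibrePr_height_succ`). [cite: Balaban1985Variational, Sect. A (11)-(14) pp.279-280] -/
theorem background_T3 {L : ℕ} (hL : 1 < L) {B₃ a₀ a₁' O₁ a₅ aF B₄ RM a₁ : ℝ} (hB₃ : 4 < B₃) (hO₁ : 1 ≤ O₁)
    (h1 : a₁ ≤ a₁') (h2 : a₁ ≤ aF) (h3 : a₁ ≤ a₅ / (O₁ * (L : ℝ) ^ 3 * B₃)) (h4 : a₁ ≤ aF * RM)
    (H7 : ∀ (i : Idx L) (ε₀ ε₁ : ℝ), 0 < ε₁ → ∀ V : (famX L i).Bdry, (famX L i).Reg7 ε₁ V →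
      ∀ U₀ : (famX L i).Cfg, (famX L i).InU ((L : ℝ) ^ 3 * B₃ * ε₁) U₀ → (famX L i).InB V U₀ →
        (ε₀ ≤ a₀ → B₃ * ε₁ ≤ ε₀ → (famX L i).AtMostOneCriticalOrbit ε₀ V) ∧
        (ε₁ ≤ a₁' → ∃ U : (famX L i).Cfg, (famX L i).OnMinimalOrbit (O₁ * (L : ℝ) ^ 3 * B₃ * ε₁) V U))
    (H8 : ∀ (i : Idx L) (ε₀ ε₁ : ℝ), 0 < ε₁ → ∀ (V : (famX L i).Bdry) (U : (famX L i).Cfg),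
      (famX L i).Reg7 ε₁ V → (famX L i).InU ε₀ U → (famX L i).InB V U → (famX L i).IsCritical V U → ε₀ ≤ a₅ → (famX L i).InU (B₃ * ε₁) U)
    (HF : ∀ (i : Idx L) (ε₁ : ℝ) (V : (famX L i).Bdry) (U : (famX L i).Cfg), 0 < ε₁ → ε₁ ≤ aF → (famX L i).Reg7 ε₁ V →
      (famX L i).InU (B₃ * ε₁) U → (famX L i).InB V U → (famX L i).IsCritical V U →
        ∀ c : (famX L i).Cube, (famX L i).sizeM c ≤ RM * (aF / ε₁) → Regularity (famX L i).toVarProblem B₃ B₄ ε₁ U c) :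
    ∀ (k : ℕ) (i : Idx L), i.1.2.2 - i.1.2.1 = k + 1 → ∀ ε₁ : ℝ, 0 < ε₁ → ε₁ ≤ a₁ → ∀ V : (famX L i).Bdry, (famX L i).Reg7 ε₁ V →
      ∃ U₀ : (famX L i).Cfg, (famX L i).InU ((L : ℝ) ^ 3 * B₃ * ε₁) U₀ ∧ (famX L i).InB V U₀ := by
  have hB₃0 : 0 < B₃ := by linarith
  intro k
  induction k with
  | zero =>
    -- `k = 1`: «we take simply U₀ = V₀»
    rintro ⟨⟨F, n, K⟩, hF, hnK⟩ hk ε₁ hε₁ _ V hV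
    have hK : K = n + 1 := by simp only at hk; omega
    subst hK
    have hFL : ((F.L : ℕ) : ℝ) = (L : ℝ) := by rw [hF]
    obtain ⟨hreg, hfib⟩ := sat14_base F n hB₃ hε₁ hV
    rw [hFL] at hreg
    exact ⟨secTo F n (n + 1) (Nat.le_succ n) V, hreg, hfib⟩
  | succ k ih =>
    -- `k ↦ k + 1`: the minimiser at height `n + 1` over `V₀ = secTo V`, lifted by (12)–(13)
    rintro ⟨⟨F, n, K⟩, hF, hnK⟩ hk ε₁ hε₁ hε₁a V hV
    simp only at hk
    have hnK' : n + 1 < K := by omega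
    have hFL : ((F.L : ℕ) : ℝ) = (L : ℝ) := by rw [hF]
    set V₀ := secTo F n (n + 1) (Nat.le_succ n) V with hV₀
    have hV₀reg : PlaqSmall ε₁ V₀ := plaqSmall_secTo F (Nat.le_succ n) hε₁ hV
    -- the inductive hypothesis at height `n + 1`, then Theorem 1's existence clause there
    obtain ⟨U₁, hU₁, hU₁B⟩ := ih ⟨(F, n + 1, K), hF, hnK'⟩ (by simp only; omega) ε₁ hε₁ hε₁a V₀ hV₀reg
    obtain ⟨hex, -, -⟩ := thm1_clauses_of_background_T3 hL hB₃0 hO₁ h1 h2 h3 h4 H7 H8 HF ⟨(F, n + 1, K), hF, hnK'⟩ ε₁ hε₁ hε₁a V₀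
      hV₀reg U₁ hU₁ hU₁B
    obtain ⟨U', hU'mem, -⟩ := (exists8_iff B₃ ε₁ V₀).mp hex
    -- (12)–(13): the lift to the height `n`, `C₁ = L³`
    have h13 := mem_regFibrePr_height_succ F hnK'.le (mul_pos hB₃0 hε₁).le hU'mem
    obtain ⟨hfib, hreg⟩ := (mem_regFibrePr_iff F).mp h13
    refine ⟨U', ?_, hfib⟩
    show RegPr F n K ((L : ℝ) ^ 3 * B₃ * ε₁) U'
    rw [← hFL, mul_assoc]
    exact hreg

/-! ## §3 Theorem 1 at the carriers; the stub from the leaves -/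

/-- **[Balaban1985Variational] THEOREM 1 AT THE d = 3 CARRIERS FROM PROP 7-FROM-(14), PROP 8 AND SECT. F** (the printed induction on `k` with its
architecture discharged; `B₃ > 4` for the `k = 1` background): one block of constants `C` (`C.B₃ = B₃`, `a₁ = min{a₁′, a_F, a₅/(O₁L³B₃), a₀/B₃, a_F R_M}`,
`M(·) ≡ 1` = unit cubes, which the carrier's point data are) with `Thm1At C` at EVERY member of `T3Thm1Carrier.fam L`, and the cover `1 ≤ M(ε₁)`.
[cite: Balaban1985Variational, Thm 1 p.279, Sect. A pp.279-280, Prop 7 p.299, Prop 8 p.304, Sect. F (169) p.305] -/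
theorem thm1At_fam_of_prop7_prop8_sectF {L : ℕ} (hL : 1 < L) {B₃ : ℝ} (hB₃ : 4 < B₃)
    (H7 : ∃ a₀ a₁' O₁ : ℝ, 0 < a₀ ∧ 0 < a₁' ∧ 1 ≤ O₁ ∧ ∀ (i : Idx L) (ε₀ ε₁ : ℝ), 0 < ε₁ → ∀ V : (famX L i).Bdry, (famX L i).Reg7 ε₁ V →
      ∀ U₀ : (famX L i).Cfg, (famX L i).InU ((L : ℝ) ^ 3 * B₃ * ε₁) U₀ → (famX L i).InB V U₀ →
        (ε₀ ≤ a₀ → B₃ * ε₁ ≤ ε₀ → (famX L i).AtMostOneCriticalOrbit ε₀ V) ∧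
        (ε₁ ≤ a₁' → ∃ U : (famX L i).Cfg, (famX L i).OnMinimalOrbit (O₁ * (L : ℝ) ^ 3 * B₃ * ε₁) V U))
    (H8 : Prop8Printed B₃ (famX L)) (HF : SectFPrinted B₃ (famX L)) :
    ∃ C : B11Thm1.Consts, C.B₃ = B₃ ∧ (∀ ε₁ : ℝ, 0 < ε₁ → ε₁ ≤ C.a₁ → 1 ≤ C.Mfun ε₁) ∧ ∀ i : Idx L, Thm1At C (fam L i) := by
  obtain ⟨a₀, a₁', O₁, ha₀, ha₁', hO₁, H7⟩ := H7
  obtain ⟨a₅, ha₅, H8⟩ := H8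
  obtain ⟨aF, B₄, RM, haF, hB₄, hRM, HF⟩ := HF
  have hB₃0 : 0 < B₃ := by linarith
  have hL0 : (0 : ℝ) < L := by exact_mod_cast (zero_lt_one.trans hL)
  have hK : 0 < O₁ * (L : ℝ) ^ 3 * B₃ := by positivity
  -- the final `a₁` (p. 304 «a largest constant such that the restriction ε₁ ≤ a₁ implies all the other restrictions»)
  set a₁ : ℝ := min (min a₁' aF) (min (a₅ / (O₁ * (L : ℝ) ^ 3 * B₃)) (min (a₀ / B₃) (aF * RM))) with ha₁_def
  have ha₁ : 0 < a₁ := lt_min (lt_min ha₁' haF) (lt_min (div_pos ha₅ hK) (lt_min (div_pos ha₀ hB₃0) (mul_pos haF hRM)))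
  have h1 : a₁ ≤ a₁' := (min_le_left _ _).trans (min_le_left _ _)
  have h2 : a₁ ≤ aF := (min_le_left _ _).trans (min_le_right _ _)
  have h3 : a₁ ≤ a₅ / (O₁ * (L : ℝ) ^ 3 * B₃) := (min_le_right _ _).trans (min_le_left _ _)
  have h4' : a₁ ≤ a₀ / B₃ := (min_le_right _ _).trans ((min_le_right _ _).trans (min_le_left _ _))
  have h4 : a₁ ≤ aF * RM := (min_le_right _ _).trans ((min_le_right _ _).trans (min_le_right _ _))
  have hB₃a₁ : B₃ * a₁ ≤ a₀ := by
    have := (le_div_iff₀ hB₃0).1 h4'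
    linarith [mul_comm B₃ a₁]
  refine ⟨⟨a₀, a₁, B₃, B₄, fun _ => 1, ha₀, ha₁, hB₃0, hB₄, hB₃a₁, fun _ _ => one_pos⟩, rfl, fun _ _ _ => le_rfl, ?_⟩
  intro i ε₁ hε₁ hε₁a V hV
  obtain ⟨U₀, hU₀, hU₀B⟩ := background_T3 hL hB₃ hO₁ h1 h2 h3 h4 H7 H8 HF (i.1.2.2 - i.1.2.1 - 1) i (by have := i.2.2; omega)
    ε₁ hε₁ hε₁a V hV
  exact thm1_clauses_of_background_T3 hL hB₃0 hO₁ h1 h2 h3 h4 H7 H8 HF i ε₁ hε₁ hε₁a V hV U₀ hU₀ hU₀B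

/-- **THE REGISTERED BODY OF `stub_variational` FROM THE LEAVES**: if at every admissible block size `L` some `B₃ > 4` carries Prop 7-from-(14)
(background `𝔘_k(L³B₃ε₁)`, `O₁ ≥ 1`), `B11.Prop8Printed B₃`, `B11.SectFPrinted B₃` at the carriers `T3Thm1Carrier.famX L`, and attainment over
(6)(ε₀) at some window with the same `B₃`, then `∀ L, ∃ a₀ a₁ B₃ B₄ > 0, MinSixAttainedAt ∧ MinimisersIn8At ∧ MinimiserCurvGradAt` — §3 +
`stub_variational_of_printed`.  The located content of the stub is thus exactly: [7] Sects. B–E (Prop 7 from a background), Sect. F (Prop 8 and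
(169)), and (142)-attainment, each for the (0.4)-averaging problem of the family. [cite: Balaban1985Variational, Thm 1 p.279, Prop 7 p.299, Prop 8 p.304] -/
theorem stub_variational_of_leaves
    (hyp : ∀ L : ℕ, 1 < L → ∃ B₃ : ℝ, 4 < B₃ ∧
      (∃ a₀ a₁' O₁ : ℝ, 0 < a₀ ∧ 0 < a₁' ∧ 1 ≤ O₁ ∧ ∀ (i : Idx L) (ε₀ ε₁ : ℝ), 0 < ε₁ → ∀ V : (famX L i).Bdry, (famX L i).Reg7 ε₁ V →
        ∀ U₀ : (famX L i).Cfg, (famX L i).InU ((L : ℝ) ^ 3 * B₃ * ε₁) U₀ → (famX L i).InB V U₀ →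
          (ε₀ ≤ a₀ → B₃ * ε₁ ≤ ε₀ → (famX L i).AtMostOneCriticalOrbit ε₀ V) ∧
          (ε₁ ≤ a₁' → ∃ U : (famX L i).Cfg, (famX L i).OnMinimalOrbit (O₁ * (L : ℝ) ^ 3 * B₃ * ε₁) V U)) ∧
      Prop8Printed B₃ (famX L) ∧ SectFPrinted B₃ (famX L) ∧ ∃ â₀ â₁ : ℝ, 0 < â₀ ∧ 0 < â₁ ∧ MinSixAttainedAt L â₀ â₁ B₃) :
    ∀ (L : ℕ), ∃ a₀ a₁ B₃ B₄ : ℝ, 0 < a₀ ∧ 0 < a₁ ∧ 0 < B₃ ∧ 0 < B₄ ∧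
      MinSixAttainedAt L a₀ a₁ B₃ ∧ MinimisersIn8At L a₀ a₁ B₃ ∧ MinimiserCurvGradAt L a₀ a₁ B₃ B₄ := by
  refine stub_variational_of_printed fun L hL => ?_
  obtain ⟨B₃, hB₃, H7, H8, HF, â₀, â₁, hâ₀, hâ₁, hatt⟩ := hyp L hL
  obtain ⟨C, hCB, hM, H⟩ := thm1At_fam_of_prop7_prop8_sectF hL hB₃ H7 H8 HF
  subst hCB
  exact ⟨C, H, hM, H8, â₀, â₁, hâ₀, hâ₁, hatt⟩

end Summit.QuantumFields.YangMills.Theorems.Variational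

end
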